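import Mathlib
import HarnessLib

/-!
# The Sylvester–Kac matrix: characteristic polynomial, and Armitage's Ehrenfest generator

**The matrix and the theorem.** The *Sylvester–Kac matrix* of order `n` is the `(n+1) × (n+1)`
tridiagonal matrix `S_n` with zero diagonal, superdiagonal `n, n-1, …, 1` and subdiagonal
`1, 2, …, n` (`(S_n)_{i,i+1} = n - i`, `(S_n)_{i+1,i} = i + 1`, indices `0, …, n`). Its
characteristic values are `n, n-2, …, -n+2, -n` — stated by Sylvester (1854), proved by Mazza
(1866) and, by generating functions, by Kac [cite: Kac1947, §4] (the matrix of the Ehrenfest urn /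
discrete Ornstein–Uhlenbeck model); history and several proofs in Taussky–Todd
[cite: TausskyTodd1991, §1–§3 ("the characteristic values are … n, n-2, …, -n+2, -n")]. Here:

* `charpoly_kacMatrix` : over ANY commutative ring, `det(X·I - S_n) = ∏_{k=0}^{n} (X - (2k - n))`
  (`charpoly_kacMatrix_int` over `ℤ`, then base change `Matrix.charpoly_map`).

**Proof formalised** (the generating-function proof, [cite: Kac1947, §4], [cite: TausskyTodd1991,
§3 "Generation of characteristic vectors"]): the operator `D_n f = (1 - X²) f' + n X f` (`kacOp`)
satisfies `D_{a+b}((X+1)^a (1-X)^b) = (a-b)·(X+1)^a (1-X)^b` (`kacOp_eigen`), and on coefficient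
vectors of polynomials of degree `≤ n` it acts as `v ↦ v · S_n` (`coeffVec_vecMul_kacMatrix`); so
the coefficient vectors of `(X+1)^k (1-X)^{n-k}`, `k = 0, …, n`, are row eigenvectors for the
`n+1` integers `2k - n` (`kacMatrix_vecMul_eigen`). Over the domain `ℤ` these are `n+1` distinct
roots of the monic degree-`n+1` characteristic polynomial, which is therefore their product
(`charpoly_eq_prod_X_sub_C_of_eigen`, a roots-counting lemma: `Multiset.prod_X_sub_C_dvd_iff_le_roots`
+ degrees); the identity is then mapped to any commutative ring.

**Armitage's finite "completed zeta".** J. V. Armitage [cite: Armitage1989, §5] replaces the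
Ornstein–Uhlenbeck semigroup behind Riemann's `ξ` by the random walk (5.2)
`V(k,(s+1)σ) = ½(1 + k/R)V(k+1,sσ) + ½(1 - k/R)V(k-1,sσ)` on `2R+1` lattice points `k = -R, …, R`,
with the `(2R+1) × (2R+1)` matrix `C` of (5.6) — first row `(0, …, 0, 1)`, row `j` with `1 - j/2R`
in column `j-1` and `j/2R` in column `j+1`, last row `(1, 0, …, 0)` — and the generator
`L = (R/2)(C - I)` of (5.8), and states (display after (5.10)) `det(zI + 2L) = z(z-1)(z-2)⋯(z-2R)`,
which makes the resolvents in his finite-level `Z_R(½ + iτ)` (5.10) exist for `½ ± iτ ∉ {0,…,2R}`.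
This is proved here for every `R ≥ 1`:

* `charpoly_armitageK` : for `N ≥ 2` the integer matrix `armitageK N = N • C` has characteristic
  polynomial `∏_{k=0}^{N} (X - (N - 2k))` (the Sylvester–Kac spectrum: rows `0` and `N` of `N • C`
  form a 2-cycle with row eigenvectors `e₀ ± e_N`, eigenvalues `±N`; on the interior, `N • C` maps
  the coefficient vector of `X·f`, `deg f ≤ N-2`, to that of `X·D_{N-2} f` — a transposed
  `S_{N-2}` — `armitageK_mulVec_interior`);
* `charpoly_neg_two_armitageL`, `det_armitage` : `det(z·I + 2L) = ∏_{m=0}^{2R} (z - m)` over `ℚ`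
  (`armitageC`, `armitageL` are (5.6), (5.8) verbatim, states relabelled `j = k + R`;
  `armitageC_apply` displays the printed entries).

Everything is proved; no named facts. Mathlib has characteristic polynomials, `Matrix.eval_charpoly`,
`Matrix.exists_vecMul_eq_zero_iff`, but no Sylvester–Kac / Clement / Ehrenfest matrix
(`lean search "Kac matrix|Clement matrix|Krawtchouk|Ehrenfest"`: no relevant hits, 2026-08-20).
Motivation: the RH construction census (t8, spec `t8-r4-019`) records Armitage's spectral claim as
the finite-level positive control of his construction; this file certifies it for all `R`
(construction census at finite level; no RH claim).
-/

noncomputable section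

namespace Literature.LinearAlgebra.Matrix

open Polynomial

namespace SylvesterKac

variable {R : Type*} [CommRing R]

/-- Kac's differential operator on polynomials, `D_n f = (1 - X²) f' + n·X f`; on polynomials of
degree `≤ n` its matrix in the monomial basis is the (transposed) Sylvester–Kac matrix. [folklore] -/
def kacOp (n : ℕ) (f : R[X]) : R[X] :=
  (1 - X ^ 2) * derivative f + C (n : R) * (X * f)

/-- Constant coefficient of `D_n f`: `[X⁰] D_n f = a_1`. [folklore] -/
private theorem coeff_kacOp_zero (n : ℕ) (f : R[X]) : (kacOp n f).coeff 0 = f.coeff 1 := by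
  simp [kacOp, sub_mul, coeff_derivative, mul_comm]

/-- Coefficients of `D_n f`: `[X^{m+1}] D_n f = (m+2)·a_{m+2} + (n-m)·a_m`. [folklore] -/
private theorem coeff_kacOp_succ (n : ℕ) (f : R[X]) (m : ℕ) :
    (kacOp n f).coeff (m + 1) = ((m : R) + 2) * f.coeff (m + 2) + ((n : R) - m) * f.coeff m := by
  have h1 : ((1 - X ^ 2 : R[X]) * derivative f).coeff (m + 1)
      = ((m : R) + 2) * f.coeff (m + 2) - (m : R) * f.coeff m := by
    rw [sub_mul, one_mul, coeff_sub, coeff_derivative, pow_two, mul_assoc, coeff_X_mul]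
    cases m with
    | zero => simp; ring
    | succ k =>
      rw [coeff_X_mul, coeff_derivative]
      push_cast
      ring
  have h2 : (C (n : R) * (X * f)).coeff (m + 1) = (n : R) * f.coeff m := by
    rw [coeff_C_mul, coeff_X_mul]
  rw [kacOp, coeff_add, h1, h2]
  ring

/-- The eigen-relation `D_{a+b} ((X+1)^a (1-X)^b) = (a - b)·(X+1)^a (1-X)^b`
(Kac's generating-function computation). [cite: Kac1947, §4] -/
theorem kacOp_eigen (a b : ℕ) :
    kacOp (a + b) ((X + 1 : R[X]) ^ a * (1 - X) ^ b)
      = C ((a : R) - b) * ((X + 1) ^ a * (1 - X) ^ b) := by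
  have hP : (X + 1 : R[X]) * derivative ((X + 1 : R[X]) ^ a) = C (a : R) * (X + 1) ^ a := by
    cases a with
    | zero => simp
    | succ k =>
      rw [derivative_pow_succ]
      simp only [derivative_add, derivative_X, derivative_one, add_zero, mul_one]
      push_cast
      ring
  have hQ : (1 - X : R[X]) * derivative ((1 - X : R[X]) ^ b) = - C (b : R) * (1 - X) ^ b := by
    cases b with
    | zero => simp
    | succ k =>
      rw [derivative_pow_succ]
      simp only [derivative_sub, derivative_X, derivative_one, zero_sub, mul_neg, mul_one]
      push_cast
      ring
  rw [kacOp, derivative_mul]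
  simp only [Nat.cast_add, map_add, map_sub]
  linear_combination ((1 - X : R[X]) ^ b * (1 - X)) * hP + ((X + 1 : R[X]) ^ a * (X + 1)) * hQ

/-! ### Two bookkeeping sums over `Fin (n+1)` -/

/-- `∑_x g(x)·[a = x+1]·c(x) = g(a-1)c(a-1)` (or `0` if `a = 0`), for `a ≤ n`. [folklore] -/
private theorem sum_mul_ite_eq_succ (n : ℕ) (g c : ℕ → R) (a : ℕ) (ha : a ≤ n) :
    (∑ x : Fin (n + 1), g x * (if a = (x : ℕ) + 1 then c x else 0))
      = if a = 0 then 0 else g (a - 1) * c (a - 1) := by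
  split_ifs with h0
  · exact Finset.sum_eq_zero fun x _ => by simp [h0]
  · obtain ⟨b, rfl⟩ : ∃ b, a = b + 1 := ⟨a - 1, by omega⟩
    have hb : b < n + 1 := by omega
    rw [Finset.sum_eq_single ⟨b, hb⟩]
    · simp
    · intro x _ hx
      have : b ≠ (x : ℕ) := fun h => hx (Fin.ext h.symm)
      simp [this]
    · simp

/-- `∑_x g(x)·[x = a+1]·c(x) = g(a+1)c(a+1)` (or `0` if `a ≥ n`). [folklore] -/
private theorem sum_mul_ite_eq_pred (n : ℕ) (g c : ℕ → R) (a : ℕ) :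
    (∑ x : Fin (n + 1), g x * (if (x : ℕ) = a + 1 then c x else 0))
      = if n ≤ a then 0 else g (a + 1) * c (a + 1) := by
  split_ifs with h0
  · exact Finset.sum_eq_zero fun x _ => by
      have : (x : ℕ) ≠ a + 1 := by omega
      simp [this]
  · have hb : a + 1 < n + 1 := by omega
    rw [Finset.sum_eq_single ⟨a + 1, hb⟩]
    · simp
    · intro x _ hx
      have : (x : ℕ) ≠ a + 1 := fun h => hx (Fin.ext h)
      simp [this]
    · simp

/-! ### Eigenvalues from eigenvectors -/

/-- If an `ι × ι` matrix over an integral domain has, for each of `card ι` pairwise distinct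
scalars `μ k`, a (left or right) eigenvector, then its characteristic polynomial is
`∏_k (X - μ k)` (distinct characteristic values ⇒ the characteristic polynomial is their
product). [cite: TausskyTodd1991, §1 ("the characteristic values are distinct … diagonalizable")] -/
theorem charpoly_eq_prod_X_sub_C_of_eigen {ι : Type*} [Fintype ι] [DecidableEq ι]
    {S : Type*} [CommRing S] [IsDomain S] (M : Matrix ι ι S) (μ : ι → S)
    (hμ : Function.Injective μ)
    (h : ∀ k, (∃ v : ι → S, v ≠ 0 ∧ Matrix.vecMul v M = μ k • v) ∨
              (∃ v : ι → S, v ≠ 0 ∧ Matrix.mulVec M v = μ k • v)) :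
    M.charpoly = ∏ k, (X - C (μ k)) := by
  classical
  -- every `μ k` is a root of the characteristic polynomial
  have hroot : ∀ k, M.charpoly.IsRoot (μ k) := by
    intro k
    rw [IsRoot.def, Matrix.eval_charpoly]
    have hsc : Matrix.scalar ι (μ k) - M = -(M - Matrix.scalar ι (μ k)) := by abel
    rw [hsc, Matrix.det_neg, mul_eq_zero]
    right
    rcases h k with ⟨v, hv, hvM⟩ | ⟨v, hv, hvM⟩
    · refine Matrix.exists_vecMul_eq_zero_iff.mp ⟨v, hv, ?_⟩
      rw [Matrix.vecMul_sub, hvM, Matrix.scalar_apply]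
      ext i
      simp
    · refine Matrix.exists_mulVec_eq_zero_iff.mp ⟨v, hv, ?_⟩
      rw [Matrix.sub_mulVec, hvM, Matrix.scalar_apply]
      ext i
      simp
  have hp0 : M.charpoly ≠ 0 := (Matrix.charpoly_monic M).ne_zero
  set s : Multiset S := (Finset.univ : Finset ι).val.map μ with hs
  have hsnd : s.Nodup := (Finset.univ : Finset ι).nodup.map hμ
  have hle : s ≤ M.charpoly.roots := by
    rw [Multiset.le_iff_subset hsnd]
    intro a ha
    obtain ⟨k, -, rfl⟩ := Multiset.mem_map.mp ha
    exact (mem_roots hp0).mpr (hroot k)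
  have hdvd : (s.map fun a => X - C a).prod ∣ M.charpoly :=
    (Multiset.prod_X_sub_C_dvd_iff_le_roots hp0 s).mpr hle
  have hq : (∏ k, (X - C (μ k)) : S[X]) = (s.map fun a => X - C a).prod := by
    rw [hs, Multiset.map_map, Finset.prod_eq_multiset_prod]
    rfl
  rw [hq]
  symm
  refine eq_of_dvd_of_natDegree_le_of_leadingCoeff hdvd ?_ ?_
  · rw [natDegree_multiset_prod_X_sub_C_eq_card, Matrix.charpoly_natDegree_eq_dim, hs,
      Multiset.card_map, Finset.card_val]
    exact Finset.card_univ.ge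
  · rw [(monic_multisetProd_X_sub_C s).leadingCoeff, (Matrix.charpoly_monic M).leadingCoeff]

/-- Primed form of `sum_mul_ite_eq_succ` (matrix entry on the left). [folklore] -/
private theorem sum_ite_mul_eq_succ (n : ℕ) (g c : ℕ → R) (a : ℕ) (ha : a ≤ n) :
    (∑ x : Fin (n + 1), (if a = (x : ℕ) + 1 then c x else 0) * g x)
      = if a = 0 then 0 else c (a - 1) * g (a - 1) := by
  rw [show (∑ x : Fin (n + 1), (if a = (x : ℕ) + 1 then c x else 0) * g x)
      = ∑ x : Fin (n + 1), g x * (if a = (x : ℕ) + 1 then c x else 0)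
      from Finset.sum_congr rfl fun x _ => mul_comm _ _, sum_mul_ite_eq_succ n g c a ha]
  split_ifs <;> simp [mul_comm]

/-- Primed form of `sum_mul_ite_eq_pred` (matrix entry on the left). [folklore] -/
private theorem sum_ite_mul_eq_pred (n : ℕ) (g c : ℕ → R) (a : ℕ) :
    (∑ x : Fin (n + 1), (if (x : ℕ) = a + 1 then c x else 0) * g x)
      = if n ≤ a then 0 else c (a + 1) * g (a + 1) := by
  rw [show (∑ x : Fin (n + 1), (if (x : ℕ) = a + 1 then c x else 0) * g x)
      = ∑ x : Fin (n + 1), g x * (if (x : ℕ) = a + 1 then c x else 0)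
      from Finset.sum_congr rfl fun x _ => mul_comm _ _, sum_mul_ite_eq_pred n g c a]
  split_ifs <;> simp [mul_comm]

/-! ### The Sylvester–Kac matrix -/

/-- The **Sylvester–Kac matrix** `S_n` of order `n`: the `(n+1) × (n+1)` tridiagonal matrix with
zero diagonal, superdiagonal `n, n-1, …, 1` (`S_{i,i+1} = n - i`) and subdiagonal `1, 2, …, n`
(`S_{i+1,i} = i + 1`), rows and columns indexed by `0, …, n`.
[cite: TausskyTodd1991, §1 (the matrix of Sylvester 1854 / Kac 1947)] [cite: Kac1947, §4] -/
def kacMatrix (n : ℕ) : Matrix (Fin (n + 1)) (Fin (n + 1)) R :=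
  Matrix.of fun i j =>
    (if (j : ℕ) = (i : ℕ) + 1 then ((n : R) - (i : ℕ)) else 0) +
    (if (i : ℕ) = (j : ℕ) + 1 then ((i : ℕ) : R) else 0)

/-- Entries of the Sylvester–Kac matrix. [cite: TausskyTodd1991, §1] -/
theorem kacMatrix_apply (n : ℕ) (i j : Fin (n + 1)) :
    (kacMatrix n : Matrix _ _ R) i j =
      (if (j : ℕ) = (i : ℕ) + 1 then ((n : R) - (i : ℕ)) else 0) +
      (if (i : ℕ) = (j : ℕ) + 1 then ((i : ℕ) : R) else 0) := rfl

/-- The Sylvester–Kac matrix over `R` is the image of the integer one. [folklore] -/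
private theorem kacMatrix_map_intCast (n : ℕ) :
    (kacMatrix n : Matrix _ _ ℤ).map (Int.castRingHom R) = kacMatrix n := by
  ext i j
  simp [kacMatrix_apply, apply_ite (Int.cast : ℤ → R)]

/-- The eigenpolynomials `(X+1)^k (1-X)^{n-k}` whose coefficient vectors are the left
eigenvectors of `S_n` (generating-function form of the Kac / Taussky–Todd eigenvectors).
[cite: TausskyTodd1991, §3] -/
def kacPoly (n k : ℕ) : R[X] := (X + 1) ^ k * (1 - X) ^ (n - k)

/-- `deg (X+1)^k (1-X)^{n-k} ≤ n` for `k ≤ n`. [folklore] -/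
private theorem natDegree_kacPoly_le (n k : ℕ) (hk : k ≤ n) : (kacPoly n k : R[X]).natDegree ≤ n := by
  unfold kacPoly
  have hX1 : (X + 1 : R[X]).natDegree ≤ 1 :=
    (natDegree_add_le _ _).trans (max_le natDegree_X_le (by simp))
  have hX2 : (1 - X : R[X]).natDegree ≤ 1 :=
    (natDegree_sub_le _ _).trans (max_le (by simp) natDegree_X_le)
  refine (natDegree_mul_le).trans ?_
  refine (add_le_add (natDegree_pow_le_of_le k hX1) (natDegree_pow_le_of_le (n - k) hX2)).trans ?_
  omega

/-- The eigenpolynomials have constant term `1` (so their coefficient vectors are nonzero).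
[folklore] -/
private theorem coeff_kacPoly_zero (n k : ℕ) : (kacPoly n k : R[X]).coeff 0 = 1 := by
  simp [kacPoly, coeff_zero_eq_eval_zero]

/-- `D_n ((X+1)^k (1-X)^{n-k}) = (2k - n)·(X+1)^k (1-X)^{n-k}`. [cite: Kac1947, §4] -/
theorem kacOp_kacPoly (n k : ℕ) (hk : k ≤ n) :
    kacOp n (kacPoly n k : R[X]) = C (2 * (k : R) - n) * kacPoly n k := by
  have h := kacOp_eigen (R := R) k (n - k)
  rw [Nat.add_sub_cancel' hk] at h
  rw [kacPoly, h, Nat.cast_sub hk]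
  congr 2
  ring

/-- The coefficient vector of a polynomial `f` of degree `≤ n`, as a row vector times `S_n`,
is the coefficient vector of `D_n f` (the monomial-basis matrix of `D_n` is `S_nᵀ`).
[cite: TausskyTodd1991, §3] -/
theorem coeffVec_vecMul_kacMatrix (n : ℕ) (f : R[X]) (hf : f.natDegree ≤ n) :
    Matrix.vecMul (fun i : Fin (n + 1) => f.coeff i) (kacMatrix n)
      = fun j : Fin (n + 1) => (kacOp n f).coeff j := by
  ext j
  have hj : (j : ℕ) ≤ n := Nat.lt_succ_iff.mp j.isLt
  simp only [Matrix.vecMul, dotProduct, kacMatrix_apply, mul_add, Finset.sum_add_distrib]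
  have h1 := sum_mul_ite_eq_succ n (fun x => f.coeff x) (fun x => (n : R) - x) j hj
  have h2 := sum_mul_ite_eq_pred n (fun x => f.coeff x) (fun x => (x : R)) j
  rw [h1, h2]
  rcases j with ⟨_ | m, hm⟩
  · -- column 0
    simp only [↓reduceIte, zero_add, Nat.cast_one]
    rw [coeff_kacOp_zero]
    split_ifs with h0
    · have : f.natDegree < 1 := by omega
      simp [coeff_eq_zero_of_natDegree_lt this]
    · simp
  · simp only [Nat.add_eq_zero_iff, one_ne_zero, and_false, ↓reduceIte, Nat.add_sub_cancel]
    rw [coeff_kacOp_succ]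
    split_ifs with h0
    · have : f.natDegree < m + 2 := by omega
      rw [coeff_eq_zero_of_natDegree_lt this]
      ring
    · push_cast
      ring

/-- Row-eigenvector relation `v_k S_n = (2k - n) v_k` for the coefficient vector `v_k` of
`(X+1)^k (1-X)^{n-k}`. [cite: TausskyTodd1991, §3] -/
theorem kacMatrix_vecMul_eigen (n : ℕ) (k : Fin (n + 1)) :
    Matrix.vecMul (fun i : Fin (n + 1) => (kacPoly n k : R[X]).coeff i) (kacMatrix n)
      = (2 * (k : R) - n) • fun i : Fin (n + 1) => (kacPoly n k : R[X]).coeff i := by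
  have hk : (k : ℕ) ≤ n := Nat.lt_succ_iff.mp k.isLt
  rw [coeffVec_vecMul_kacMatrix n _ (natDegree_kacPoly_le n k hk), kacOp_kacPoly n k hk]
  ext i
  simp only [coeff_C_mul, Pi.smul_apply, smul_eq_mul]

/-- **Sylvester–Kac theorem** over `ℤ`: `det (X·I - S_n) = ∏_{k=0}^{n} (X - (2k - n))`, i.e. the
eigenvalues of `S_n` are `-n, -n+2, …, n-2, n`. [cite: TausskyTodd1991, §1–§2] [cite: Kac1947, §4] -/
theorem charpoly_kacMatrix_int (n : ℕ) :
    (kacMatrix n : Matrix _ _ ℤ).charpoly = ∏ k : Fin (n + 1), (X - C (2 * (k : ℤ) - n)) := by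
  refine charpoly_eq_prod_X_sub_C_of_eigen _ (fun k : Fin (n + 1) => 2 * (k : ℤ) - n) ?_ ?_
  · intro a b hab
    have : (a : ℤ) = b := by
      have := hab
      simp only at this
      linarith
    exact Fin.ext (by exact_mod_cast this)
  · intro k
    left
    refine ⟨fun i => (kacPoly n k : ℤ[X]).coeff i, ?_, kacMatrix_vecMul_eigen n k⟩
    intro h
    have := congr_fun h 0
    simp [coeff_kacPoly_zero] at this

/-- **Sylvester–Kac theorem** over any commutative ring: the characteristic polynomial of the
Sylvester–Kac matrix `S_n` is `∏_{k=0}^{n} (X - (2k - n))`.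
[cite: TausskyTodd1991, §1–§2] [cite: Kac1947, §4] -/
theorem charpoly_kacMatrix (n : ℕ) :
    (kacMatrix n : Matrix _ _ R).charpoly = ∏ k : Fin (n + 1), (X - C (2 * (k : R) - n)) := by
  rw [← kacMatrix_map_intCast, Matrix.charpoly_map, charpoly_kacMatrix_int, Polynomial.map_prod]
  refine Finset.prod_congr rfl fun k _ => ?_
  rw [Polynomial.map_sub, Polynomial.map_X, Polynomial.map_C]
  congr 2
  simp only [eq_intCast, Int.cast_sub, Int.cast_mul, Int.cast_ofNat, Int.cast_natCast]

/-! ### Armitage's cyclic Ehrenfest matrix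

Armitage [cite: Armitage1989, §5 eqs. (5.2), (5.6)–(5.8)] approximates Riemann's `ξ` through the
random walk `V(k,(s+1)σ) = ½(1 + k/R) V(k+1, sσ) + ½(1 - k/R) V(k-1, sσ)` on the `2R+1` lattice
points `k = -R, …, R`, encoded by the `(2R+1) × (2R+1)` matrix `C` of (5.6): first row
`(0, …, 0, 1)`, row `j` (`1 ≤ j ≤ 2R-1`) with `1 - j/2R` in column `j-1` and `j/2R` in column
`j+1`, last row `(1, 0, …, 0)` (states relabelled `j = k + R ∈ {0, …, 2R}`; the two corner
entries `1` are the printed wrap-around moves), and the generator `L = (R/2)(C - I)` of (5.8), for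
which he states `det(zI + 2L) = z(z-1)(z-2)⋯(z-2R)`. Below `armitageK N = N • C` for `N = 2R`
(integer entries), and the statement is proved for every `R ≥ 1` (`charpoly_neg_two_armitageL`,
`det_armitage`): rows `0` and `N` of `N • C` only see each other (a 2-cycle with eigenvalues `±N`,
row eigenvectors `e₀ ± e_N`), and on the interior block `N • C` acts on coefficient vectors of
`X·f`, `deg f ≤ N-2`, as the transposed Sylvester–Kac matrix `S_{N-2}`, so the spectrum of `N • C`
is again `N, N-2, …, -N`. -/

/-- `N • C` for Armitage's `(N+1)`-state Markov matrix `C` of [cite: Armitage1989, eq. (5.6)]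
(`N = 2R`): row `0` is `N·e_N`, row `N` is `N·e_0`, and row `i` (`0 < i < N`) has `N - i` in
column `i-1` and `i` in column `i+1`. -/
def armitageK (N : ℕ) : Matrix (Fin (N + 1)) (Fin (N + 1)) R :=
  Matrix.of fun i j =>
    if (i : ℕ) = 0 then (if (j : ℕ) = N then (N : R) else 0)
    else if (i : ℕ) = N then (if (j : ℕ) = 0 then (N : R) else 0)
    else (if (j : ℕ) = (i : ℕ) + 1 then ((i : ℕ) : R) else 0) +
         (if (i : ℕ) = (j : ℕ) + 1 then ((N : R) - (i : ℕ)) else 0)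

/-- Entries of `armitageK N = N • C`. [cite: Armitage1989, eq. (5.6)] -/
theorem armitageK_apply (N : ℕ) (i j : Fin (N + 1)) :
    (armitageK N : Matrix _ _ R) i j =
      if (i : ℕ) = 0 then (if (j : ℕ) = N then (N : R) else 0)
      else if (i : ℕ) = N then (if (j : ℕ) = 0 then (N : R) else 0)
      else (if (j : ℕ) = (i : ℕ) + 1 then ((i : ℕ) : R) else 0) +
           (if (i : ℕ) = (j : ℕ) + 1 then ((N : R) - (i : ℕ)) else 0) := rfl

/-- `armitageK` over `R` is the image of the integer one. [folklore] -/
private theorem armitageK_map_intCast (N : ℕ) :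
    (armitageK N : Matrix _ _ ℤ).map (Int.castRingHom R) = armitageK N := by
  ext i j
  simp [armitageK_apply, apply_ite (Int.cast : ℤ → R)]

/-- Row eigenvector `e₀ + e_N` of `N • C`, eigenvalue `N` (the two wrap-around corner entries of
[cite: Armitage1989, eq. (5.6)] form a 2-cycle). -/
theorem armitageK_vecMul_top (N : ℕ) (hN : 1 ≤ N) :
    Matrix.vecMul (fun j : Fin (N + 1) => if (j : ℕ) = 0 ∨ (j : ℕ) = N then (1 : R) else 0)
        (armitageK N)
      = (N : R) • fun j : Fin (N + 1) => if (j : ℕ) = 0 ∨ (j : ℕ) = N then (1 : R) else 0 := by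
  ext j
  have h0N : (0 : Fin (N + 1)) ≠ Fin.last N := by
    intro h; have := congrArg Fin.val h; simp at this; omega
  simp only [Matrix.vecMul, dotProduct, Pi.smul_apply, smul_eq_mul]
  rw [Finset.sum_eq_add (0 : Fin (N + 1)) (Fin.last N) h0N]
  · simp only [armitageK_apply, Fin.val_zero, Fin.val_last, ↓reduceIte, true_or, or_true,
      one_mul]
    have hN0 : N ≠ 0 := by omega
    simp only [hN0, ↓reduceIte]
    by_cases hj0 : (j : ℕ) = 0
    · simp [hj0, Ne.symm hN0]
    · by_cases hjN : (j : ℕ) = N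
      · simp [hjN, hN0]
      · simp [hj0, hjN]
  · intro c _ hc
    have hc0 : (c : ℕ) ≠ 0 := fun h => hc.1 (Fin.ext (by simpa using h))
    have hcN : (c : ℕ) ≠ N := fun h => hc.2 (Fin.ext (by simpa using h))
    simp [hc0, hcN]
  · simp
  · simp

/-- Row eigenvector `e₀ - e_N` of `N • C`, eigenvalue `-N`. [cite: Armitage1989, eq. (5.6)] -/
theorem armitageK_vecMul_bot (N : ℕ) (hN : 1 ≤ N) :
    Matrix.vecMul (fun j : Fin (N + 1) =>
        if (j : ℕ) = 0 then (1 : R) else if (j : ℕ) = N then -1 else 0) (armitageK N)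
      = (-(N : R)) • fun j : Fin (N + 1) =>
        if (j : ℕ) = 0 then (1 : R) else if (j : ℕ) = N then -1 else 0 := by
  ext j
  have h0N : (0 : Fin (N + 1)) ≠ Fin.last N := by
    intro h; have := congrArg Fin.val h; simp at this; omega
  simp only [Matrix.vecMul, dotProduct, Pi.smul_apply, smul_eq_mul]
  rw [Finset.sum_eq_add (0 : Fin (N + 1)) (Fin.last N) h0N]
  · simp only [armitageK_apply, Fin.val_zero, Fin.val_last, ↓reduceIte, one_mul]
    have hN0 : N ≠ 0 := by omega
    simp only [hN0, ↓reduceIte]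
    by_cases hj0 : (j : ℕ) = 0
    · simp [hj0, Ne.symm hN0]
    · by_cases hjN : (j : ℕ) = N
      · simp [hjN, hN0]
      · simp [hj0, hjN]
  · intro c _ hc
    have hc0 : (c : ℕ) ≠ 0 := fun h => hc.1 (Fin.ext (by simpa using h))
    have hcN : (c : ℕ) ≠ N := fun h => hc.2 (Fin.ext (by simpa using h))
    simp [hc0, hcN]
  · simp
  · simp

/-- Interior column eigenvectors of `N • C`, `N = n + 2`: the coefficient vector of
`X · (X+1)^a (1-X)^{n-a}` (`a ≤ n`), eigenvalue `2a - n` (rows `1, …, N-1` of `N • C` act on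
coefficient vectors of `X·f` as `X·D_n f`, a transposed Sylvester–Kac matrix `S_n`).
[cite: Armitage1989, §5 eqs. (5.6)–(5.8)] [cite: Kac1947, §4] -/
theorem armitageK_mulVec_interior (n a : ℕ) (ha : a ≤ n) :
    Matrix.mulVec (armitageK (n + 2))
        (fun j : Fin (n + 2 + 1) => (X * kacPoly n a : R[X]).coeff j)
      = (2 * (a : R) - n) • fun j : Fin (n + 2 + 1) => (X * kacPoly n a : R[X]).coeff j := by
  set f : R[X] := kacPoly n a with hf
  have hfdeg : f.natDegree ≤ n := natDegree_kacPoly_le n a ha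
  have hgdeg : ∀ m, n + 2 ≤ m → (X * f).coeff m = 0 := by
    intro m hm
    refine coeff_eq_zero_of_natDegree_lt (natDegree_mul_le.trans_lt ?_)
    have := natDegree_X_le (R := R)
    omega
  have heig : ∀ m, (2 * (a : R) - n) * f.coeff m = (kacOp n f).coeff m := by
    intro m
    rw [hf, kacOp_kacPoly n a ha, coeff_C_mul]
  ext i
  simp only [Matrix.mulVec, dotProduct, Pi.smul_apply, smul_eq_mul]
  by_cases hi0 : (i : ℕ) = 0
  · -- row 0 : N · g_N = 0
    simp only [armitageK_apply, hi0, ↓reduceIte]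
    rw [Finset.sum_eq_single (Fin.last (n + 2))]
    · simp [hgdeg (n + 2) le_rfl]
    · intro b _ hb
      have : (b : ℕ) ≠ n + 2 := fun h => hb (Fin.ext (by simpa using h))
      simp [this]
    · simp
  by_cases hiN : (i : ℕ) = n + 2
  · -- row N : N · g_0 = 0
    simp only [armitageK_apply, hiN, ↓reduceIte, Nat.add_eq_zero_iff, OfNat.ofNat_ne_zero,
      and_false]
    rw [Finset.sum_eq_single (0 : Fin (n + 2 + 1))]
    · simp [hgdeg (n + 2) le_rfl]
    · intro b _ hb
      have : (b : ℕ) ≠ 0 := fun h => hb (Fin.ext (by simpa using h))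
      simp [this]
    · simp
  -- interior row i = m + 1, m ≤ n
  simp only [armitageK_apply, hi0, hiN, ↓reduceIte, add_mul, Finset.sum_add_distrib]
  have hi : (i : ℕ) ≤ n + 2 := Nat.lt_succ_iff.mp i.isLt
  have h1 := sum_ite_mul_eq_pred (n + 2) (fun x => (X * f).coeff x) (fun _ => ((i : ℕ) : R)) i
  have h2 := sum_ite_mul_eq_succ (n + 2) (fun x => (X * f).coeff x)
    (fun _ => ((n + 2 : ℕ) : R) - (i : ℕ)) i hi
  rw [h1, h2]
  obtain ⟨m, hm⟩ : ∃ m, (i : ℕ) = m + 1 := ⟨(i : ℕ) - 1, by omega⟩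
  have hmn : m ≤ n := by omega
  simp only [hm, Nat.add_eq_zero_iff, one_ne_zero, and_false, ↓reduceIte, Nat.add_sub_cancel,
    coeff_X_mul, show ¬ (n + 2 ≤ m + 1) from by omega]
  rw [heig m]
  rcases m with _ | m'
  · rw [coeff_kacOp_zero]
    simp
  · rw [coeff_kacOp_succ, coeff_X_mul]
    push_cast
    ring

/-- For `N ≥ 2`, every `N - 2k` (`k = 0, …, N`) has a row or a column eigenvector of `N • C`
(explicitly: `e₀ ± e_N`, and the coefficient vectors of `X (X+1)^a (1-X)^{N-2-a}`).
[cite: Armitage1989, §5 eqs. (5.6)–(5.8)] -/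
theorem armitageK_eigen [Nontrivial R] (N : ℕ) (hN : 2 ≤ N) (k : Fin (N + 1)) :
    (∃ v : Fin (N + 1) → R, v ≠ 0 ∧ Matrix.vecMul v (armitageK N) = ((N : R) - 2 * (k : ℕ)) • v) ∨
    (∃ v : Fin (N + 1) → R, v ≠ 0 ∧
      Matrix.mulVec (armitageK N) v = ((N : R) - 2 * (k : ℕ)) • v) := by
  obtain ⟨n, rfl⟩ : ∃ n, N = n + 2 := ⟨N - 2, by omega⟩
  by_cases hk0 : (k : ℕ) = 0
  · left
    refine ⟨fun j : Fin (n + 2 + 1) => if (j : ℕ) = 0 ∨ (j : ℕ) = n + 2 then (1 : R) else 0,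
      ?_, ?_⟩
    · intro h
      have := congr_fun h 0
      simp at this
    · rw [armitageK_vecMul_top (R := R) (n + 2) (by omega), hk0]
      congr 1
      push_cast
      ring
  by_cases hkN : (k : ℕ) = n + 2
  · left
    refine ⟨fun j : Fin (n + 2 + 1) =>
        if (j : ℕ) = 0 then (1 : R) else if (j : ℕ) = n + 2 then -1 else 0, ?_, ?_⟩
    · intro h
      have := congr_fun h 0
      simp at this
    · rw [armitageK_vecMul_bot (R := R) (n + 2) (by omega), hkN]
      congr 1
      push_cast
      ring
  · right
    have hk : (k : ℕ) ≤ n + 2 := Nat.lt_succ_iff.mp k.isLt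
    have han : n + 1 - (k : ℕ) ≤ n := by omega
    refine ⟨fun j : Fin (n + 2 + 1) => (X * kacPoly n (n + 1 - (k : ℕ)) : R[X]).coeff j, ?_, ?_⟩
    · intro h
      have := congr_fun h ⟨1, by omega⟩
      simp [coeff_X_mul, coeff_kacPoly_zero] at this
    · rw [armitageK_mulVec_interior (R := R) n _ han]
      congr 1
      rw [Nat.cast_sub (by omega)]
      push_cast
      ring

/-- Spectrum of Armitage's `N • C` over `ℤ`, `N ≥ 2`: `det(X·I - N•C) = ∏_{k=0}^{N} (X - (N - 2k))`.
[cite: Armitage1989, §5 eq. (5.8)] -/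
theorem charpoly_armitageK_int (N : ℕ) (hN : 2 ≤ N) :
    (armitageK N : Matrix _ _ ℤ).charpoly = ∏ k : Fin (N + 1), (X - C ((N : ℤ) - 2 * (k : ℕ))) := by
  refine charpoly_eq_prod_X_sub_C_of_eigen _ (fun k : Fin (N + 1) => (N : ℤ) - 2 * (k : ℕ)) ?_
    (armitageK_eigen N hN)
  intro a b hab
  have : (a : ℤ) = b := by
    have := hab
    simp only at this
    linarith
  exact Fin.ext (by exact_mod_cast this)

/-- Spectrum of Armitage's `N • C` over any commutative ring (`N ≥ 2`): the characteristic
polynomial is `∏_{k=0}^{N} (X - (N - 2k))` — the Sylvester–Kac spectrum again.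
[cite: Armitage1989, §5 eq. (5.8)] -/
theorem charpoly_armitageK (N : ℕ) (hN : 2 ≤ N) :
    (armitageK N : Matrix _ _ R).charpoly = ∏ k : Fin (N + 1), (X - C ((N : R) - 2 * (k : ℕ))) := by
  rw [← armitageK_map_intCast, Matrix.charpoly_map, charpoly_armitageK_int N hN,
    Polynomial.map_prod]
  refine Finset.prod_congr rfl fun k _ => ?_
  rw [Polynomial.map_sub, Polynomial.map_X, Polynomial.map_C]
  congr 2
  simp only [eq_intCast, Int.cast_sub, Int.cast_mul, Int.cast_ofNat, Int.cast_natCast]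

/-- Armitage's Markov matrix `C` of [cite: Armitage1989, eq. (5.6)] on `2R+1` states
(`R ≥ 1`; rational entries `0, 1, j/2R, 1 - j/2R`). -/
def armitageC (R' : ℕ) : Matrix (Fin (2 * R' + 1)) (Fin (2 * R' + 1)) ℚ :=
  (1 / (2 * R' : ℚ)) • armitageK (2 * R')

/-- Armitage's generator `L = (R/2)(C - I)` of [cite: Armitage1989, eq. (5.8)]. -/
def armitageL (R' : ℕ) : Matrix (Fin (2 * R' + 1)) (Fin (2 * R' + 1)) ℚ :=
  ((R' : ℚ) / 2) • (armitageC R' - 1)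

/-- The entries of `armitageC R` are those printed in [cite: Armitage1989, eq. (5.6)]: first row
`(0, …, 0, 1)`, row `i` (`0 < i < 2R`) with `1 - i/2R` in column `i-1` and `i/2R` in column `i+1`,
last row `(1, 0, …, 0)`. -/
theorem armitageC_apply (R' : ℕ) (hR : 1 ≤ R') (i j : Fin (2 * R' + 1)) :
    armitageC R' i j =
      if (i : ℕ) = 0 then (if (j : ℕ) = 2 * R' then 1 else 0)
      else if (i : ℕ) = 2 * R' then (if (j : ℕ) = 0 then 1 else 0)
      else (if (j : ℕ) = (i : ℕ) + 1 then ((i : ℕ) : ℚ) / (2 * R') else 0) +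
           (if (i : ℕ) = (j : ℕ) + 1 then 1 - ((i : ℕ) : ℚ) / (2 * R') else 0) := by
  have hR0 : (2 * R' : ℚ) ≠ 0 := by positivity
  simp only [armitageC, Matrix.smul_apply, armitageK_apply, smul_eq_mul]
  push_cast
  split_ifs <;> field_simp <;> ring

/-- `-2L = ½ (N·I - N•C)` with `N = 2R` (from `L = (R/2)(C - I)`, [cite: Armitage1989, eq. (5.8)]). -/
theorem neg_two_smul_armitageL (R' : ℕ) (hR : 1 ≤ R') :
    -(2 : ℚ) • armitageL R' = (1 / 2 : ℚ) • (Matrix.scalar _ ((2 * R' : ℕ) : ℚ) - armitageK (2 * R')) := by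
  have hR0 : (R' : ℚ) ≠ 0 := by positivity
  ext i j
  simp only [armitageL, armitageC, Matrix.smul_apply, Matrix.sub_apply, smul_eq_mul,
    Matrix.scalar_apply, Matrix.diagonal_apply, Matrix.one_apply]
  push_cast
  split_ifs <;> field_simp <;> ring

/-- **Armitage's determinant** [cite: Armitage1989, §5, display after (5.10)]: for `R ≥ 1` the
characteristic polynomial of `-2L` is `X(X-1)(X-2)⋯(X-2R)`, i.e. `det(zI + 2L) = z(z-1)⋯(z-2R)`. -/
theorem charpoly_neg_two_armitageL (R' : ℕ) (hR : 1 ≤ R') :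
    (-(2 : ℚ) • armitageL R').charpoly = ∏ m : Fin (2 * R' + 1), (X - C ((m : ℕ) : ℚ)) := by
  rw [neg_two_smul_armitageL R' hR]
  refine charpoly_eq_prod_X_sub_C_of_eigen _ (fun m : Fin (2 * R' + 1) => ((m : ℕ) : ℚ)) ?_ ?_
  · intro a b hab
    have h := hab
    simp only [Nat.cast_inj] at h
    exact Fin.ext h
  · intro m
    rcases armitageK_eigen (R := ℚ) (2 * R') (by omega) m with ⟨v, hv, hvK⟩ | ⟨v, hv, hvK⟩
    · left
      refine ⟨v, hv, ?_⟩
      rw [Matrix.vecMul_smul, Matrix.vecMul_sub, hvK, Matrix.scalar_apply]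
      ext j
      simp
      ring
    · right
      refine ⟨v, hv, ?_⟩
      rw [Matrix.smul_mulVec, Matrix.sub_mulVec, hvK, Matrix.scalar_apply]
      ext j
      simp
      ring

/-- **Armitage's determinant**, evaluated form: `det(z·I + 2L) = ∏_{m=0}^{2R} (z - m)` for every
rational `z` and every `R ≥ 1` [cite: Armitage1989, §5, display after (5.10)] — so `2L + (½ ± iτ)I`
is invertible whenever `½ ± iτ ∉ {0, 1, …, 2R}`, as used there. -/
theorem det_armitage (R' : ℕ) (hR : 1 ≤ R') (z : ℚ) :
    (Matrix.scalar (Fin (2 * R' + 1)) z + (2 : ℚ) • armitageL R').det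
      = ∏ m : Fin (2 * R' + 1), (z - (m : ℕ)) := by
  have h := congrArg (Polynomial.eval z) (charpoly_neg_two_armitageL R' hR)
  rw [Matrix.eval_charpoly, Polynomial.eval_prod] at h
  simp only [eval_sub, eval_X, eval_C] at h
  rw [← h]
  congr 1
  ext i j
  simp [Matrix.scalar_apply, Matrix.sub_apply, Matrix.smul_apply]

/-! ### Addenda: the Ehrenfest stationary vector and the Markov normalisation -/

/-- The binomial row vector `(C(n,0), …, C(n,n))` is a row eigenvector of `S_n` for the top
eigenvalue `n` — the (unnormalised) stationary distribution of the Ehrenfest urn with `n` balls,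
whose transition matrix is `S_n / n`. [cite: Kac1947, §4] -/
theorem choose_vecMul_kacMatrix (n : ℕ) :
    Matrix.vecMul (fun i : Fin (n + 1) => ((n.choose i : ℕ) : R)) (kacMatrix n)
      = (n : R) • fun i : Fin (n + 1) => ((n.choose i : ℕ) : R) := by
  have h := kacMatrix_vecMul_eigen (R := R) n (Fin.last n)
  have hp : (kacPoly n n : R[X]) = (X + 1) ^ n := by
    simp [kacPoly]
  simp only [Fin.val_last] at h
  simp only [hp, coeff_X_add_one_pow] at h
  rw [h]
  congr 1
  ring

/-- Row sums of `S_n` are all `n`: `S_n · 𝟙 = n · 𝟙` (so `S_n / n` is a stochastic matrix).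
[cite: Kac1947, §4] -/
theorem kacMatrix_mulVec_one (n : ℕ) :
    Matrix.mulVec (kacMatrix n : Matrix _ _ R) (fun _ => 1) = fun _ => (n : R) := by
  ext i
  have hi : (i : ℕ) ≤ n := Nat.lt_succ_iff.mp i.isLt
  simp only [Matrix.mulVec, dotProduct, kacMatrix_apply, add_mul, Finset.sum_add_distrib]
  have h1 := sum_ite_mul_eq_pred n (fun _ => (1 : R)) (fun _ => (n : R) - (i : ℕ)) i
  have h2 := sum_ite_mul_eq_succ n (fun _ => (1 : R)) (fun _ => ((i : ℕ) : R)) i hi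
  rw [h1, h2]
  by_cases ha : n ≤ (i : ℕ)
  · by_cases hb : (i : ℕ) = 0
    · have hn : n = 0 := by omega
      simp [hb, hn]
    · have hin : (i : ℕ) = n := by omega
      have hn0 : n ≠ 0 := by omega
      simp [hin, hn0]
  · by_cases hb : (i : ℕ) = 0
    · have hn0 : n ≠ 0 := by omega
      simp [hb, hn0]
    · simp only [ha, hb, ↓reduceIte]
      ring

/-- Armitage's `C` is a Markov matrix ("`C` is in the Markoff algebra",
[cite: Armitage1989, §5 after eq. (5.6)]): the row sums of `N • C` are all `N`. -/
theorem armitageK_mulVec_one (N : ℕ) :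
    Matrix.mulVec (armitageK N : Matrix _ _ R) (fun _ => 1) = fun _ => (N : R) := by
  ext i
  have hi : (i : ℕ) ≤ N := Nat.lt_succ_iff.mp i.isLt
  simp only [Matrix.mulVec, dotProduct, mul_one]
  by_cases hi0 : (i : ℕ) = 0
  · simp only [armitageK_apply, hi0, ↓reduceIte]
    rw [Finset.sum_eq_single (Fin.last N)]
    · simp
    · intro b _ hb
      have : (b : ℕ) ≠ N := fun h => hb (Fin.ext (by simpa using h))
      simp [this]
    · simp
  by_cases hiN : (i : ℕ) = N
  · have hN0 : N ≠ 0 := fun h => hi0 (hiN.trans h)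
    simp only [armitageK_apply, hiN, ↓reduceIte]
    simp only [hN0, ↓reduceIte]
    rw [Finset.sum_eq_single (0 : Fin (N + 1))]
    · simp
    · intro b _ hb
      have : (b : ℕ) ≠ 0 := fun h => hb (Fin.ext (by simpa using h))
      simp [this]
    · simp
  simp only [armitageK_apply, hi0, hiN, ↓reduceIte, Finset.sum_add_distrib]
  have h1 := sum_ite_mul_eq_pred N (fun _ => (1 : R)) (fun _ => ((i : ℕ) : R)) i
  have h2 := sum_ite_mul_eq_succ N (fun _ => (1 : R)) (fun _ => (N : R) - (i : ℕ)) i hi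
  simp only [mul_one] at h1 h2
  rw [h1, h2]
  have h3 : ¬ N ≤ (i : ℕ) := by omega
  simp [h3, hi0]

/-- Armitage's `C` is row-stochastic: `C · 𝟙 = 𝟙` for `R ≥ 1`. [cite: Armitage1989, §5 (5.6)–(5.7)] -/
theorem armitageC_mulVec_one (R' : ℕ) (hR : 1 ≤ R') :
    Matrix.mulVec (armitageC R') (fun _ => 1) = fun _ => (1 : ℚ) := by
  have hR0 : (2 * R' : ℚ) ≠ 0 := by positivity
  rw [armitageC, Matrix.smul_mulVec, armitageK_mulVec_one]
  ext i
  simp only [Pi.smul_apply, smul_eq_mul]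
  push_cast
  field_simp

end SylvesterKac

end Literature.LinearAlgebra.Matrix
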